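import Summits.QuantumFields.QCD.Theses.QuarksAsStableAction
import Literature.MathematicalPhysics.QuantumLattice.WilsonFermionGramRegularity
import Literature.MathematicalPhysics.QuantumFieldTheory.LatticeSiteRPCoupling
import Literature.MathematicalPhysics.QuantumFieldTheory.TorusSiteRP
import HarnessLib

/-!
# Marginal site-reflection positivity of lattice QCD with Wilson quarks

We prove the support hypothesis `MarginalSiteRP` of the route `QuarksAsStableAction`:
for `Nf` flavours of antiperiodic Wilson quarks (`r = 1`, masses `m_f > -1`) on the torus
`(ℤ/L)⁴`, `L` even, `4 ≤ L`, the complex measure `∏_f det D_AP[U, m_f] dμ_W(U)` is reflection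
positive for the site reflection `Θ₀` in the pair of hyperplanes `t = 0`, `t = L/2`, on bounded
measurable gauge observables supported in `0 ≤ t ≤ L/2` (and not inside the plane `t = 0`):
`∫ conj F(Θ₀U) F(U) ∏_f det D_AP[U, m_f] dμ_W(U) ≥ 0`.

Proof (Osterwalder–Seiler 1978 §§2–3, Lüscher 1977, Montvay–Münster §4.2.3 — here entirely
in terms of finite determinants): by `fermionDet_wilsonDiracAP_eq_sum_gram` each determinant is a
Gram kernel `∑_{q', q} Φ_{q'}(U) Q̂_{q'q}(U) conj Φ_q(Θ₀U)` with `Q̂(U)` positive semidefinite and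
depending only on the spatial links inside the reflection planes, and with `Φ_q` depending only on
the positive-time links; the product over flavours is a Gram kernel of the same kind (Schur
product theorem, `posSemidef_piProd`); the Wilson weight factorises across the planes
(`StringTension.wilsonAction_split_site`); and the abstract site-reflection mechanism with a
positive semidefinite coupling on the shared block (`LatticeRP.integral_sum_coupling_nonneg`)
gives the sign.
-/

noncomputable section

-- `DecidableEq`/`Fintype` of the nested finite index types of the Gram expansion
-- (`Fin Nf → GramIdx h 3`) need a deeper instance search than the default.
set_option synthInstance.maxSize 512

namespace Summit.QuantumFields.QCD.Theorems

open MeasureTheory Finset Complex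
open Literature.MathematicalPhysics.QuantumLattice Literature.MathematicalPhysics.QuantumFieldTheory
open Literature.MathematicalPhysics.QuantumFieldTheory.WilsonRP (plaqRe measurable_plaqRe)
open Literature.MathematicalPhysics.QuantumFieldTheory.StringTension
open Literature.MathematicalPhysics.QuantumFieldTheory.TorusTranslation
open Literature.LinearAlgebra.Matrix (exists_eq_conjTranspose_mul_self_of_posSemidef)
open scoped ComplexOrder ComplexConjugate Matrix

/-- **Schur product theorem, product form.** For a finite family of positive semidefinite
complex matrices `Q_i ∈ M_K(ℂ)`, the matrix on `ι → K` with entries `∏_i (Q_i)_{k_i l_i}` (the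
Kronecker product of the family) is positive semidefinite. [folklore] -/
theorem posSemidef_piProd {ι K : Type*} [Fintype ι] [Fintype K] [DecidableEq K]
    (Q : ι → Matrix K K ℂ) (hQ : ∀ i, (Q i).PosSemidef) :
    (Matrix.of fun k l : ι → K => ∏ i, Q i (k i) (l i)).PosSemidef := by
  classical
  choose B hB using fun i => exists_eq_conjTranspose_mul_self_of_posSemidef (hQ i)
  have h : (Matrix.of fun k l : ι → K => ∏ i, Q i (k i) (l i)) =
      (Matrix.of fun (r : ι → K) (k : ι → K) => ∏ i, B i (r i) (k i))ᴴ *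
        Matrix.of fun (r : ι → K) (k : ι → K) => ∏ i, B i (r i) (k i) := by
    ext k l
    have hq : ∀ i, Q i (k i) (l i) = ∑ r, star (B i r (k i)) * B i r (l i) := fun i => by
      rw [hB i, Matrix.mul_apply]; rfl
    simp only [Matrix.of_apply, Matrix.mul_apply, Matrix.conjTranspose_apply, hq, star_prod,
      ← Finset.prod_mul_distrib]
    exact Fintype.prod_sum fun i r => star (B i r (k i)) * B i r (l i)
  rw [h]
  exact Matrix.posSemidef_conjTranspose_mul_self _

/-- A finite product of functions bounded in norm by constants is bounded by the product of the
constants. [folklore] -/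
theorem norm_prod_le_prod_of_le {ι : Type*} [Fintype ι] {x : ι → ℂ} {C : ι → ℝ}
    (h : ∀ i, ‖x i‖ ≤ C i) : ‖∏ i, x i‖ ≤ ∏ i, C i := by
  rw [norm_prod]
  exact Finset.prod_le_prod (fun i _ => norm_nonneg _) fun i _ => h i

/-- **Marginal site-reflection positivity of lattice QCD with antiperiodic Wilson quarks**
(support hypothesis `MarginalSiteRP` of the route `QuarksAsStableAction`): for `L` even, `4 ≤ L`,
masses `m_f > -1` and every bounded measurable gauge observable `F` depending only on the links
with both endpoints in `0 ≤ t ≤ L/2` that are not inside the plane `t = 0`,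
`∫ conj F(Θ₀U) · F(U) · ∏_f det D_AP[U, m_f] dμ_W(U)` is real and non-negative, `Θ₀` the site
reflection in the planes `t = 0, L/2` and `μ_W` the pure-gauge Wilson measure.
(Osterwalder–Seiler 1978; Lüscher 1977; Montvay–Münster §4.2.3.) [folklore] -/
theorem marginalSiteRP_proof : Summit.QuantumFields.QCD.Theses.QuarksAsStableAction.MarginalSiteRP := by
  intro Nf L _ hL h4 β m hm apDet F hF hFb hFdep
  classical
  -- `L = 2T`, `T = h + 1`
  obtain ⟨k, hk⟩ := hL
  obtain ⟨h, rfl⟩ : ∃ h, k = h + 1 := ⟨k - 1, by omega⟩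
  subst hk
  haveI : Fact (1 < h + 1 + (h + 1)) := ⟨by omega⟩
  have hE : Even (h + 1 + (h + 1)) := ⟨h + 1, rfl⟩
  have hL2 : (h + 1 + (h + 1)) / 2 = h + 1 := by omega
  -- notation
  set ρW : Matrix.specialUnitaryGroup (Fin 3) ℂ →* Matrix (Fin 3) (Fin 3) ℂ := fundamentalRep (Fin 3)
    with hρW
  have hρ : Continuous ρW := continuous_fundamentalRep (Fin 3)
  set Θ₀ : GaugeConfig 4 (h + 1 + (h + 1)) (Matrix.specialUnitaryGroup (Fin 3) ℂ) →
      GaugeConfig 4 (h + 1 + (h + 1)) (Matrix.specialUnitaryGroup (Fin 3) ℂ) := fun U =>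
    (torusConfigShift (Pi.single (0 : Fin 4) (1 : ZMod (h + 1 + (h + 1)))) U).timeReflect with hΘ₀
  have hΘfun : ∀ U : GaugeConfig 4 (h + 1 + (h + 1)) (Matrix.specialUnitaryGroup (Fin 3) ℂ),
      GaugeConfig.timeReflect (fun e => U (e.1 - Pi.single (0 : Fin 4) (1 : ZMod (h + 1 + (h + 1))), e.2)) =
        Θ₀ U := fun U => by
    simp only [hΘ₀]
    congr 1
    funext e
    exact (torusConfigShift_apply _ U e).symm
  simp only [hΘfun]
  -- the blocks of links and plaquettes
  set P₀ : Finset (Edge 4 (h + 1 + (h + 1))) := Finset.univ.filter fun e =>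
    (e.1 0).val < (h + 1 + (h + 1)) / 2 ∧ (e.2 = 0 ∨ 1 ≤ (e.1 0).val) with hP₀
  set M₀ : Finset (Edge 4 (h + 1 + (h + 1))) := Finset.univ.filter fun e =>
    e.2 ≠ 0 ∧ ((e.1 0).val = 0 ∨ (e.1 0).val = (h + 1 + (h + 1)) / 2) with hM₀
  set A : GaugeConfig 4 (h + 1 + (h + 1)) (Matrix.specialUnitaryGroup (Fin 3) ℂ) → ℝ := fun U =>
    ∑ p ∈ Finset.univ.filter (fun p : Plaquette 4 (h + 1 + (h + 1)) =>
      (p.1 0).val < (h + 1 + (h + 1)) / 2 ∧ (p.2.1.1 = 0 ∨ 1 ≤ (p.1 0).val)), plaqRe ρW U p with hA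
  set AM : GaugeConfig 4 (h + 1 + (h + 1)) (Matrix.specialUnitaryGroup (Fin 3) ℂ) → ℝ := fun U =>
    ∑ p ∈ Finset.univ.filter (fun p : Plaquette 4 (h + 1 + (h + 1)) =>
      p.2.1.1 ≠ 0 ∧ ((p.1 0).val = 0 ∨ (p.1 0).val = (h + 1 + (h + 1)) / 2)), plaqRe ρW U p with hAM
  set g : GaugeConfig 4 (h + 1 + (h + 1)) (Matrix.specialUnitaryGroup (Fin 3) ℂ) → ℝ := fun U =>
    Real.exp (β * (A U + AM U / 2)) with hg
  set c₁ : ℝ := Real.exp (-β * (3 * Fintype.card (Plaquette 4 (h + 1 + (h + 1))))) with hc₁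
  -- the weight splits across the reflection planes
  have hexp : ∀ U, Real.exp (-β * wilsonAction ρW U) = c₁ * g U * g (Θ₀ U) := fun U => by
    have hS := wilsonAction_split_site ρW hE hρ U
    have hM := sumM_siteReflect ρW hE U
    simp only [hg, hc₁, hA, hAM, hΘ₀]
    rw [← Real.exp_add, ← Real.exp_add, hS, hM]
    push_cast
    ring_nf
  -- the Gram data of the `Nf` flavours
  set Q : GaugeConfig 4 (h + 1 + (h + 1)) (Matrix.specialUnitaryGroup (Fin 3) ℂ) →
      Matrix (Fin Nf → GramIdx h 3) (Fin Nf → GramIdx h 3) ℂ := fun U =>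
    Matrix.of fun k l => ∏ f, fermionCoupling U (m f) (k f) (l f) with hQ
  set Φ : (Fin Nf → GramIdx h 3) → GaugeConfig 4 (h + 1 + (h + 1)) (Matrix.specialUnitaryGroup (Fin 3) ℂ) → ℂ :=
    fun k U => F U * (g U : ℂ) * ∏ f, fermionFeature U (m f) (k f) with hΦ
  have hdet : ∀ U, ∏ f, apDet U (m f) = ∑ k : Fin Nf → GramIdx h 3, ∑ l : Fin Nf → GramIdx h 3,
      (∏ f, fermionCoupling U (m f) (k f) (l f)) * (∏ f, fermionFeature U (m f) (k f)) *
        conj (∏ f, fermionFeature (Θ₀ U) (m f) (l f)) := fun U => by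
    have h1 : ∀ f, apDet U (m f) = ∑ q', ∑ q, fermionFeature U (m f) q' * fermionCoupling U (m f) q' q *
        conj (fermionFeature (Θ₀ U) (m f) q) := fun f =>
      fermionDet_wilsonDiracAP_eq_sum_gram U (hm f)
    simp only [h1]
    rw [Fintype.prod_sum]
    refine Finset.sum_congr rfl fun k _ => ?_
    rw [Fintype.prod_sum]
    refine Finset.sum_congr rfl fun l _ => ?_
    rw [Finset.prod_mul_distrib, Finset.prod_mul_distrib, map_prod]
    ring
  have hpt : ∀ U, ((Real.exp (-β * wilsonAction ρW U) : ℝ) : ℂ) * (conj (F (Θ₀ U)) * F U * ∏ f, apDet U (m f)) =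
      (c₁ : ℂ) * ∑ k, ∑ l, Q U k l * Φ k U * conj (Φ l (Θ₀ U)) := fun U => by
    rw [hexp U, hdet U]
    push_cast
    simp only [hΦ, hQ, Matrix.of_apply, map_mul, Complex.conj_ofReal, Finset.mul_sum]
    refine Finset.sum_congr rfl fun k _ => Finset.sum_congr rfl fun l _ => ?_
    ring
  -- hypotheses of the abstract mechanism
  have hΘmp : MeasurePreserving Θ₀ (LatticeRP.piMeasure (haarProbability (Matrix.specialUnitaryGroup (Fin 3) ℂ))) (LatticeRP.piMeasure (haarProbability (Matrix.specialUnitaryGroup (Fin 3) ℂ))) :=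
    measurePreserving_siteReflect
  have hΘM : ∀ U, ∀ e ∈ M₀, Θ₀ U e = U e := fun U e he => siteReflect_apply_of_mem_M hE U e he
  have hΘdep : ∀ e ∈ P₀, DependsOn (fun U => Θ₀ U e) ((P₀ᶜ : Finset _) : Set (Edge 4 (h + 1 + (h + 1)))) :=
    fun e he => dependsOn_siteReflect_apply hE e (by rwa [Finset.union_empty])
  have hMP : Disjoint M₀ P₀ := disjoint_M_P
  have hQm : ∀ k l, Measurable fun U => Q U k l := fun k l => by
    simp only [hQ, Matrix.of_apply]
    exact Finset.measurable_prod _ fun f _ => measurable_fermionCoupling_apply (hm f) _ _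
  have hgm : Measurable g :=
    (((Finset.measurable_sum _ fun p _ => measurable_plaqRe ρW hρ p).add
      ((Finset.measurable_sum _ fun p _ => measurable_plaqRe ρW hρ p).div_const _)).const_mul β).exp
  have hΦm : ∀ k, Measurable (Φ k) := fun k =>
    (hF.mul (Complex.measurable_ofReal.comp hgm)).mul
      (Finset.measurable_prod _ fun f _ => measurable_fermionFeature (hm f) _)
  -- bounds
  obtain ⟨B, hB⟩ := hFb
  choose CF hCF using fun f => exists_bound_fermionFeature (h := h) (N := 3) (hm f)
  choose CQ hCQ using fun f => exists_bound_fermionCoupling (h := h) (N := 3) (hm f)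
  have hgb : ∀ U, ‖(g U : ℂ)‖ ≤ Real.exp (|β| * (2 * (3 * Fintype.card (Plaquette 4 (h + 1 + (h + 1)))))) :=
    fun U => by
    rw [Complex.norm_real, Real.norm_eq_abs, abs_of_pos (Real.exp_pos _)]
    refine Real.exp_le_exp.2 ((le_abs_self _).trans ?_)
    rw [abs_mul]
    refine mul_le_mul_of_nonneg_left ?_ (abs_nonneg _)
    have hA' := abs_sum_plaqRe_le ρW hρ (Finset.univ.filter (fun p : Plaquette 4 (h + 1 + (h + 1)) =>
      (p.1 0).val < (h + 1 + (h + 1)) / 2 ∧ (p.2.1.1 = 0 ∨ 1 ≤ (p.1 0).val))) U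
    have hM' := abs_sum_plaqRe_le ρW hρ (Finset.univ.filter (fun p : Plaquette 4 (h + 1 + (h + 1)) =>
      p.2.1.1 ≠ 0 ∧ ((p.1 0).val = 0 ∨ (p.1 0).val = (h + 1 + (h + 1)) / 2))) U
    calc |A U + AM U / 2| ≤ |A U| + |AM U / 2| := abs_add_le _ _
      _ ≤ 3 * Fintype.card (Plaquette 4 (h + 1 + (h + 1))) + 3 * Fintype.card (Plaquette 4 (h + 1 + (h + 1))) := by
          rw [abs_div, abs_two]
          exact add_le_add hA' (by linarith [hM', abs_nonneg (AM U)])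
      _ = 2 * (3 * Fintype.card (Plaquette 4 (h + 1 + (h + 1)))) := by ring
  have hQb : ∀ U k l, ‖Q U k l‖ ≤ ∏ f, CQ f := fun U k l => by
    simp only [hQ, Matrix.of_apply]
    exact norm_prod_le_prod_of_le fun f => hCQ f U _ _
  have hΦb : ∀ k U, ‖Φ k U‖ ≤
      B * Real.exp (|β| * (2 * (3 * Fintype.card (Plaquette 4 (h + 1 + (h + 1)))))) * ∏ f, CF f :=
    fun k U => by
    simp only [hΦ]
    rw [norm_mul, norm_mul]
    have hB0 : 0 ≤ B := (norm_nonneg _).trans (hB U)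
    exact mul_le_mul (mul_le_mul (hB U) (hgb U) (norm_nonneg _) hB0)
      (norm_prod_le_prod_of_le fun f => hCF f _ U) (norm_nonneg _)
      (mul_nonneg hB0 (Real.exp_pos _).le)
  -- locality
  have hQdep : ∀ k l, DependsOn (fun U => Q U k l) ((M₀ : Finset _) : Set (Edge 4 (h + 1 + (h + 1)))) :=
    fun k l U V hUV => by
    simp only [hQ, Matrix.of_apply]
    refine Finset.prod_congr rfl fun f _ => ?_
    rw [fermionCoupling_congr (U := U) (V := V) (fun e he1 he2 => hUV e ?_) (m f)]
    rw [Finset.mem_coe, hM₀, Finset.mem_filter]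
    exact ⟨Finset.mem_univ _, he1, he2⟩
  have hQpsd : ∀ U, (Q U).PosSemidef := fun U =>
    posSemidef_piProd (fun f => fermionCoupling U (m f)) fun f => posSemidef_fermionCoupling U (hm f)
  have hΦdep : ∀ k, DependsOn (Φ k) ((P₀ ∪ M₀ : Finset _) : Set (Edge 4 (h + 1 + (h + 1)))) :=
    fun k U V hUV => by
    have hUV' : ∀ e ∈ (((P₀ ∪ ∅ ∪ M₀) : Finset _) : Set (Edge 4 (h + 1 + (h + 1)))), U e = V e := by
      rw [Finset.union_empty]; exact hUV
    have hFUV : F U = F V := by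
      refine hFdep U V fun e he => hUV e ?_
      rw [Finset.mem_coe, Finset.mem_union, hP₀, hM₀, Finset.mem_filter, Finset.mem_filter]
      by_cases h0 : e.2 = 0
      · left
        rw [if_pos h0] at he
        exact ⟨Finset.mem_univ _, by omega, Or.inl h0⟩
      · rw [if_neg h0] at he
        by_cases h1 : 1 ≤ (e.1 0).val
        · by_cases h2 : (e.1 0).val < (h + 1 + (h + 1)) / 2
          · exact Or.inl ⟨Finset.mem_univ _, h2, Or.inr h1⟩
          · exact Or.inr ⟨Finset.mem_univ _, h0, Or.inr (by omega)⟩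
        · exact Or.inr ⟨Finset.mem_univ _, h0, Or.inl (by omega)⟩
    have hgUV : g U = g V := by
      simp only [hg, hA, hAM]
      exact weightSite_congr ρW β hUV'
    have hfUV : ∀ f, fermionFeature U (m f) (k f) = fermionFeature V (m f) (k f) := fun f =>
      fermionFeature_congr (fun e he1 he2 => hUV e (by
        rw [Finset.mem_coe, Finset.mem_union, hP₀, Finset.mem_filter]
        exact Or.inl ⟨Finset.mem_univ _, he1, he2⟩)) (m f) (k f)
    simp only [hΦ, hFUV, hgUV, hfUV]
  -- the mechanism
  have hI := LatticeRP.integral_sum_coupling_nonneg (haarProbability (Matrix.specialUnitaryGroup (Fin 3) ℂ)) M₀ P₀ Θ₀ hΘmp hΘM hΘdep hMP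
    hQm hΦm hQb hΦb hQdep hQpsd hΦdep
  -- unfold the Wilson measure
  have hdens : Measurable fun U : GaugeConfig 4 (h + 1 + (h + 1)) (Matrix.specialUnitaryGroup (Fin 3) ℂ) =>
      ENNReal.ofReal (Real.exp (-β * wilsonAction ρW U)) :=
    ENNReal.measurable_ofReal.comp ((WilsonRP.measurable_wilsonAction ρW hρ).const_mul (-β)).exp
  rw [eq_comm, ← Complex.nonneg_iff]
  unfold wilsonMeasure
  rw [integral_smul_measure]
  unfold wilsonWeight
  rw [integral_withDensity_eq_integral_toReal_smul hdens (ae_of_all _ fun _ => ENNReal.ofReal_lt_top)]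
  simp_rw [ENNReal.toReal_ofReal (Real.exp_nonneg _), Complex.real_smul, hpt]
  rw [integral_const_mul]
  refine mul_nonneg (Complex.zero_le_real.2 ENNReal.toReal_nonneg)
    (mul_nonneg (Complex.zero_le_real.2 (Real.exp_pos _).le) ?_)
  exact hI

end Summit.QuantumFields.QCD.Theorems

end
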